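/-
Copyright (c) 2026 the pub-hodgecm-mathlib formalisation cell (harness21).  Prover seat hodgecm-mathlib-K2E3-p31 (g3) = the (DICT-Σ) ASSEMBLER OF RECORD (S4 dealer K2E2-plan
(g8) S4-R45 (1), 2026-09-05T02:35:45Z), Track B «K2-LIT», R90-TF section S4 (h413 = `stmt-HodgeConjecture-24833`): the payer of Lines-C ED. 6's merged socket
`stub_R90_S4_stableTransportDictCountT` (the stable transport dictionary (DICT) + the T-side Weyl count (WEYL-COUNT-T) of the twisted Weyl integration formula), assembled from the
per-Cartan-type member packages.  THEOREMS ONLY (no `def`, no `instance`, no notation, no named-fact hypothesis, no `sorry`); ★-only imports, NO `Lines` import.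
-/
import Summits.HodgeConjecture.HodgeConjecture.Theorems.R90S4StableDictOfMemberPackages     -- ★ p864386 (K2E3-p12): `isStableTransportDict_and_isTwistedWeylCountT_of_forall_member`; brings ★ TrivialTypes (`exists_memberPackage_of_stable_eq_class`, `isConj_of_isStablyConjGAt_of_eq_cmTorus`), ★ `IsFinerCount`, ★ `IsStableTransportDict`, ★ `IsTwistedWeylCountT`, `cartanWeight`
import Summits.HodgeConjecture.HodgeConjecture.Theorems.R90S4TypeOneFinerCount             -- ★ F5b (R90-C131-p01): `exists_typeOne_memberPackage_finer`, `centralizer_eq_of_mem_member`, `member_eq_of_isConj`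
import Summits.HodgeConjecture.HodgeConjecture.Theorems.R90S4TypeOneEpsWeylIndex           -- ★ p864420 (R90-C131-p05): `index_centralizer_subgroupOf_epsNormalizer_eq_six_of_typeOne`; brings ★ `exists_eigenframe_of_typeOne`
import Summits.HodgeConjecture.HodgeConjecture.Theorems.R90S4TypeOneTorusClasses           -- ★ F3a: `exists_eigenframe_coords_of_mem_centralizer`
import Summits.HodgeConjecture.HodgeConjecture.Theorems.R90S4EpsWeylIndexOfStableEqClass   -- ★ p864427 (K2E3-p12): `index_epsNormalizer_eq_weylIndex_member_of_stable_eq_class`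
import Summits.HodgeConjecture.HodgeConjecture.Theorems.R90S4RegularCharpolyTypeSplit      -- ★ CARD D (K2E4-p11): `charpoly_shape_of_not_mem_hyperbolicSet`, `not_mem_hyperbolicSet_of_ne_M`
import Summits.HodgeConjecture.HodgeConjecture.Theorems.R90S4TypeTwoBlockFrameOfCharpoly   -- ★ FILE 0 (K2E4-p14): `exists_blockFrame_gqs_of_charpoly`
import Summits.HodgeConjecture.HodgeConjecture.Theorems.R90S4CubicCartanStableClass        -- ★ (K2E3-p27): `isConj_of_isStablyConjGAt_of_isField_cartanAlgebra`
import Summits.HodgeConjecture.HodgeConjecture.Theorems.F0P3cStCharTSWeylFinite            -- ★ (F0P3a): `index_centralizer_subgroupOf_normalizer_ne_zero` (`[N(T):T] ≠ 0`, regular generator)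
import Summits.HodgeConjecture.HodgeConjecture.Theorems.R90S4TypeTwoTorusClasses           -- ★ p864762 CARD A FILE 1 (K2E3-p12): `exists_blockFrame_of_mem_centralizer_of_isRegularElt` ([H-A2])
import Summits.HodgeConjecture.HodgeConjecture.Theorems.R90S4TypeTwoMemberPackage          -- ★ CARD A FILE 2 (K2E3-p12): `exists_typeTwo_memberPackage_finer` ([H-A])
import Summits.HodgeConjecture.HodgeConjecture.Theorems.R90S4TypeTwoEpsWeylIndex           -- ★ p864756 CARD C (R90-C131-p05): `index_centralizer_subgroupOf_epsNormalizer_eq_two_of_typeTwo` ([H-C])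
import Summits.HodgeConjecture.HodgeConjecture.Theorems.R90S4CubicCartanFieldBridge        -- ★ p864787 CARD F (K2Liu-p05): `isField_cartanAlgebra_of_irreducible_charpoly_gqs`, `isField_cartanAlgebra_of_mem_centralizer_of_isRegularElt` ([H-F1′]∕[H-F2])
import HarnessLib

/-!
# R90-TF · S4 «Ch. 13.1–2» — (DICT-Σ) THE ASSEMBLY: `IsStableTransportDict L v C n ∧ IsTwistedWeylCountT L v C n` for a Cartan system `C` of `U(Φ₃)(L⁺_v)`
# (Rogawski 1990, §3.6 pp. 28–31; §12.5 pp. 182, 186)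

Cell `hodgecm-mathlib`, crux H413 (`stmt-HodgeConjecture-24833`, lane `--supports … --as helper`), route of record `HCCMUnconditional` (no route verbs;
count-neutral).  Programme R90-TF, section S4; S4 dealer K2E2-plan (g8), S4-R45 (1): K2E3-p31 (g3) is the (DICT-Σ) assembler of record.  CONSUMER: typist R90-C131-typ1 (g2),
`Cruxes/H413/Lines/R90_S4_LocalBaseChangeC.lean` ED. 6, socket `stub_R90_S4_stableTransportDictCountT (hv) (C) (hM) (hZ) (hcpt) (hcov) (hirr) : ∃ n, IsStableTransportDict L v C n ∧
IsTwistedWeylCountT L v C n` (probe `R90/R90-C131-typ1/g2/c6/ED6_probe.v2.lean` :31–:42; `GLoc L v = Gqs L v` reducibly).  BRIEF = R90-C131-p01 (g2)'s census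
`R90/R90-C131-p01/g2/CENSUS-DICT-SIGMA-assembly.md` §1–§5 + S4-R40∕41∕43; my census `K2/K2E3-p31/g3/CENSUS-DICT-SIGMA-assembler.K2E3-p31-g3.md`.

THE MATHEMATICS (Rogawski p. 182: «the number of `ν ∈ 𝔇(T∕F)` such that `T^ν` is conjugate to `T″` is `|Ω_F(T)|∕|Ω(T″)|`»; §3.6 types (0)–(3)).  A Cartan system `C` (letters `hZ`:
`T = Z(γ_T)`, `γ_T` regular; `hcpt`: every `T ≠ M` compact; `hcov`, `hirr`: the `G_v`-classes of Cartans are represented exactly once) carries the STABLE TRANSPORT DICTIONARY ★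
`IsStableTransportDict L v C n` and the T-SIDE WEYL COUNT ★ `IsTwistedWeylCountT L v C n` of ★ p864386 as soon as every member `T_i` has a MEMBER PACKAGE — transports
`e_j : T_i ≃ₜ* T_{τ j}` realising the `G_v`-classes inside the stable class of every regular `t ∈ T_i` ((S)(W)(B)), with reachability, count and type-transport rows — and the
per-type counts `μ` (`|𝔇(T∕F)|`), `wF` (`|Ω_F(T)| = [Ñ^ε_T : T̃]`) satisfy ★ `IsFinerCount` and the (W̃ε-VAL) row.  THE COUNTS ARE ASSIGNED BY A PRIORITY CHAIN ON INTRINSIC TYPE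
PREDICATES that never tests the split torus `M`: `P1 i` = «`T_i = Z(γ)` for a `γ` with three distinct norm-one rational eigenvalues» (type (1): `μ = 4`, `wF = 6`, ★ F5b), `P2 i` =
«`T_i = Z(γ)` for a `γ` with a block frame `A ⊕ u`, `A.charpoly` irreducible» (type (2): `μ = 2`, `wF = 2`, CARD A), else CHEAP (`μ = 1`, `wF = [N(T):T]`; by EXHAUSTION at the
generator — ★ CARD D `charpoly_shape_of_not_mem_hyperbolicSet` + ★ FILE 0 — a cheap member is `M` or CUBIC, where stable class = class on regular points: ★
`isConj_of_isStablyConjGAt_of_eq_cmTorus` ∕ CARD F + ★ `isConj_of_isStablyConjGAt_of_isField_cartanAlgebra`).  Along reachability the chain value is preserved (type (1): (T3);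
type (2): (T3″) and «a reachable `k` of type (1) would reach `i` back» by F5b's symmetric (T1)); so no exclusivity lemma between the types is needed.
* §1 letter conversions weylShape → map-shape (`hcov`, `hirr`); §2 generic fibre sum; §3 member uniqueness; §4 the cheap branch's «stable = class» by exhaustion;
* §5 **`stableTransportDictCountT_of_rows`** — the assembly, hypothesis-first over the five per-type rows [H-A] ★ CARD A `exists_typeTwo_memberPackage_finer`, [H-A2] ★
  `exists_blockFrame_of_mem_centralizer_of_isRegularElt` (K2E3-p12), [H-C] ★ CARD C (R90-C131-p05), [H-F1′]∕[H-F2] ★ CARD F (K2Liu-p05); everything else ★ BY NAME.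
* §6 **`stableTransportDictCountT_of_record`** — THE SOCKET'S BYTES (probe v2 :31–:42, `GLoc` spelled `Gqs`): §5 with the five rows discharged by the ★ names (one λ each).

HONEST LABEL: HC_CM is proved only modulo the 7 printed citations (2 remaining named inputs: hLiu418 = stmt-HodgeConjecture-24832, h413 =
stmt-HodgeConjecture-24833) until rung 0 closes.  This file pays C's (DICT)+(WEYL-COUNT-T) sub-socket (typist's glue: `exact stableTransportDictCountT_of_record L v hv C hM hZ hcpt hcov hirr`); (W-NP) ∕ (B1) ∕ (J̃♭) stay OPEN; REL ≠ ★ ≠ BUILT.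

[cite: Rogawski1990, §3.6 pp. 28–31; §12.5 pp. 182, 186; §3.5 Prop. 3.5.2 p. 29] [cite: HarishChandra1970, Lemma 42]
-/

set_option autoImplicit false
-- the mandated namespace repeats the single-problem summit's segment (`HodgeConjecture.HodgeConjecture`)
set_option linter.dupNamespace false

noncomputable section

open NumberField IsDedekindDomain Matrix
open scoped MatrixGroups
open Literature.NumberTheory.Rogawski1990 Literature.NumberTheory.Automorphic Literature.NumberTheory.Automorphic.UnitaryGroup
open Summit.HodgeConjecture.HodgeConjecture.Cruxes.H413

namespace Summit.HodgeConjecture.HodgeConjecture.R90.S4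

section Assembly

variable (L : Type) [Field L] [NumberField L] [IsCMField L] (v : HeightOneSpectrum (𝓞 ↥(maximalRealSubfield L)))

/-! ## §1 The CARTAN-ALL letters `hcov`, `hirr`: the socket's weylShape ⇒ the packages' map-shape -/

variable {L v} in
/-- **`hcov` weylShape ⇒ map-shape**: «`g ∈ Z(γ) ↔ x⁻¹ g x ∈ T`» ⇒ `Z(γ) = T.map (MulAut.conj x)` (Mathlib `Subgroup.mem_map_equiv`, `MulAut.conj_symm_apply`). [cite: Rogawski1990, §3.1 p. 19] -/
theorem cartanCover_map_of_weylShape {Car : Finset (Subgroup (Gqs L v))}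
    (hcov : ∀ γ : Gqs L v, IsRegularElt (γ.val : GL (Fin 3) (LocalRing L v)) →
      ∃ T ∈ Car, ∃ x : Gqs L v, ∀ g : Gqs L v, g ∈ Subgroup.centralizer ({γ} : Set (Gqs L v)) ↔ x⁻¹ * g * x ∈ T) :
    ∀ γ : Gqs L v, IsRegularElt (γ.val : GL (Fin 3) (LocalRing L v)) →
      ∃ T ∈ Car, ∃ x : Gqs L v, Subgroup.centralizer ({γ} : Set (Gqs L v)) = T.map (MulAut.conj x).toMonoidHom := by
  intro γ hγ
  obtain ⟨T, hT, x, hx⟩ := hcov γ hγ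
  refine ⟨T, hT, x, Subgroup.ext fun g => ?_⟩
  rw [hx g, Subgroup.mem_map_equiv, MulAut.conj_symm_apply]

variable {L v} in
/-- **`hirr` weylShape ⇒ map-shape**: no two members are conjugate. [cite: Rogawski1990, §3.1 p. 19; §12.5 p. 182] -/
theorem cartanIrr_map_of_weylShape {Car : Finset (Subgroup (Gqs L v))}
    (hirr : ∀ T ∈ Car, ∀ T' ∈ Car, T ≠ T' → ∀ y : Gqs L v, ¬ ∀ h : Gqs L v, h ∈ T' ↔ y⁻¹ * h * y ∈ T) :
    ∀ T ∈ Car, ∀ T' ∈ Car, (∃ x : Gqs L v, T.map (MulAut.conj x).toMonoidHom = T') → T = T' := by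
  intro T hT T' hT' ⟨x, hx⟩
  by_contra hne
  refine hirr T hT T' hT' hne x fun h => ?_
  rw [← hx, Subgroup.mem_map_equiv, MulAut.conj_symm_apply]

/-! ## §2 Generic: the fibres of a finite family exhaust it; a non-empty finite fibre -/

/-- `Σ_{k′} #{j : τ j = k′} = k` for `τ : Fin k → ι`. [folklore] -/
theorem sum_natCard_fiber_eq {ι : Type*} [Fintype ι] [DecidableEq ι] {k : ℕ} (τ : Fin k → ι) :
    ∑ k' : ι, Nat.card {j : Fin k // τ j = k'} = k := by
  have h : ∀ k' : ι, Nat.card {j : Fin k // τ j = k'} = (Finset.univ.filter fun j : Fin k => τ j = k').card := fun k' => by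
    rw [Nat.card_eq_fintype_card, Fintype.card_subtype]
  simp only [h]
  rw [← Finset.card_eq_sum_card_fiberwise fun j _ => Finset.mem_univ (τ j), Finset.card_univ, Fintype.card_fin]

/-- `#{j : τ j = k′} ≠ 0 ↔ ∃ j, τ j = k′`. [folklore] -/
theorem natCard_fiber_ne_zero_iff {ι : Type*} {k : ℕ} (τ : Fin k → ι) (k' : ι) :
    Nat.card {j : Fin k // τ j = k'} ≠ 0 ↔ ∃ j, τ j = k' := by
  rw [Nat.card_ne_zero]
  exact ⟨fun ⟨⟨j⟩, _⟩ => ⟨j.1, j.2⟩, fun ⟨j, hj⟩ => ⟨⟨⟨j, hj⟩⟩, inferInstance⟩⟩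

/-! ## §3 Members: a regular element lies in exactly one member -/

variable {L v} in
/-- Two members of the Cartan system containing a common REGULAR element are equal (both are its centraliser, ★ `centralizer_eq_of_mem_member`).
[cite: Rogawski1990, §3.1 p. 19; §3.6 p. 28] -/
theorem member_eq_of_mem_of_isRegularElt {Car : Finset (Subgroup (Gqs L v))}
    (hZ : ∀ T ∈ Car, ∃ γ : Gqs L v, IsRegularElt (γ.val : GL (Fin 3) (LocalRing L v)) ∧ T = Subgroup.centralizer ({γ} : Set (Gqs L v)))
    {i i' : ↥Car} {t : Gqs L v} (ht : t ∈ (i : Subgroup (Gqs L v))) (ht' : t ∈ (i' : Subgroup (Gqs L v)))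
    (hreg : IsRegularElt (t.val : GL (Fin 3) (LocalRing L v))) : i = i' :=
  Subtype.ext ((centralizer_eq_of_mem_member hZ i.2 ht hreg).symm.trans (centralizer_eq_of_mem_member hZ i'.2 ht' hreg))

/-! ## §4 The cheap branch: a member which is neither of type (1) nor of type (2) has «stable class = class» on its regular points -/

variable {L v} in
/-- **EXHAUSTION AT THE GENERATOR.**  Let `T_i = Z(γ₀)` (`γ₀` regular) be a member with every `T ≠ M` compact (`hcpt`), which is NOT of type (1) (no generator with three
distinct norm-one rational eigenvalues) and NOT of type (2) (no generator with an irreducible-quadratic block frame).  Then stable class = class on `T_i^{reg}`: either `T_i = M`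
(★ `isConj_of_isStablyConjGAt_of_eq_cmTorus`), or `γ₀ ∉ Ω` (★ `not_mem_hyperbolicSet_of_ne_M`) and by ★ CARD D `charpoly_shape_of_not_mem_hyperbolicSet` the characteristic
polynomial of `γ₀` is irreducible (the split shape is type (1), the quadratic shape gives a block frame by ★ FILE 0 `exists_blockFrame_gqs_of_charpoly`, i.e. type (2)) — a CUBIC
member, whose Cartan algebra is a field at `γ₀` ([H-F1′]) hence at every regular `t ∈ T_i` ([H-F2]), so ★ `isConj_of_isStablyConjGAt_of_isField_cartanAlgebra` applies.
[cite: Rogawski1990, §3.6 pp. 28–31; §12.5 p. 182] -/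
theorem stable_eq_class_of_not_typeOne_of_not_typeTwo (hv : ∀ w : PlacesOver L v, IsCMField.complexConj L • w.1 = w.1) {Car : Finset (Subgroup (Gqs L v))}
    (hZ : ∀ T ∈ Car, ∃ γ : Gqs L v, IsRegularElt (γ.val : GL (Fin 3) (LocalRing L v)) ∧ T = Subgroup.centralizer ({γ} : Set (Gqs L v)))
    (hcpt : ∀ T ∈ Car, T ≠ (cmBorelTriple L 3 v).M → IsCompact (T : Set (Gqs L v)))
    -- [H-F1′] CARD F §1′ (K2E3-p27 (g3))
    (HF1 : ∀ γ : Gqs L v, Irreducible (γ.val.val : Matrix (Fin 3) (Fin 3) (LocalRing L v)).charpoly →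
      IsField ↥(cartanAlgebra (γ.val.val : Matrix (Fin 3) (Fin 3) (LocalRing L v))))
    -- [H-F2] CARD F §2 corollary (K2E3-p27 (g3))
    (HF2 : ∀ γ t : Gqs L v, IsRegularElt (γ.val : GL (Fin 3) (LocalRing L v)) →
      IsField ↥(cartanAlgebra (γ.val.val : Matrix (Fin 3) (Fin 3) (LocalRing L v))) → t ∈ Subgroup.centralizer ({γ} : Set (Gqs L v)) →
      IsRegularElt (t.val : GL (Fin 3) (LocalRing L v)) → IsField ↥(cartanAlgebra (t.val.val : Matrix (Fin 3) (Fin 3) (LocalRing L v))))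
    (i : ↥Car)
    (h1 : ¬ ∃ (γ : Gqs L v) (u : Fin 3 → LocalRing L v), Function.Injective u ∧ (∀ k, conjLocal L (IsCMField.complexConj L) v (u k) * u k = 1) ∧
      γ.val.val.charpoly = ∏ k, (Polynomial.X - Polynomial.C (u k)) ∧ (i : Subgroup (Gqs L v)) = Subgroup.centralizer ({γ} : Set (Gqs L v)))
    (h2 : ¬ ∃ (γ : Gqs L v) (P : GL (Fin 3) (LocalRing L v)) (e : Fin 2 ⊕ Fin 1 ≃ Fin 3) (A : Matrix (Fin 2) (Fin 2) (LocalRing L v)) (u : LocalRing L v),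
      γ.val.val * P.val = P.val * Matrix.reindex e e (Matrix.fromBlocks A 0 0 !![u]) ∧ Irreducible A.charpoly ∧
        (i : Subgroup (Gqs L v)) = Subgroup.centralizer ({γ} : Set (Gqs L v))) :
    ∀ t : ↥(i : Subgroup (Gqs L v)), IsRegularElt (((t : Gqs L v)).val : GL (Fin 3) (LocalRing L v)) →
      ∀ γ' : Gqs L v, IsStablyConjGAt L (R90.S4.splitFormGL L) v (t : Gqs L v) γ' → IsConj (t : Gqs L v) γ' := by
  obtain ⟨γ₀, hreg, hi⟩ := hZ (i : Subgroup (Gqs L v)) i.2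
  by_cases hM : (i : Subgroup (Gqs L v)) = (cmBorelTriple L 3 v).M
  · exact isConj_of_isStablyConjGAt_of_eq_cmTorus hv hM
  have hΩ := not_mem_hyperbolicSet_of_ne_M hcpt i.2 hreg hi hM
  rcases charpoly_shape_of_not_mem_hyperbolicSet hv γ₀ hreg hΩ with hirr | ⟨q, u, hq, -, hq2, -, hchar⟩ | ⟨u, hu, hu1, hchar⟩
  · -- CUBIC: the Cartan algebra is a field at `γ₀`, hence at every regular `t ∈ T_i = Z(γ₀)`
    intro t ht γ' hst
    have htZ : (t : Gqs L v) ∈ Subgroup.centralizer ({γ₀} : Set (Gqs L v)) := hi ▸ t.2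
    exact isConj_of_isStablyConjGAt_of_isField_cartanAlgebra hv ht (HF2 γ₀ (t : Gqs L v) hreg (HF1 γ₀ hirr) htZ ht) hst
  · -- quadratic shape ⇒ a block frame ⇒ type (2), excluded
    obtain ⟨P, e, A, hP, -, hA⟩ := exists_blockFrame_gqs_of_charpoly L v hv γ₀ q u hq hq2 hchar
    exact (h2 ⟨γ₀, P, e, A, u, hP, hA, hi⟩).elim
  · -- split shape ⇒ type (1), excluded
    exact (h1 ⟨γ₀, u, hu, hu1, hchar, hi⟩).elim

/-! ## §5 THE ASSEMBLY (rows in flight as hypotheses) -/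

variable {L v} in
/-- **(DICT-Σ) THE ASSEMBLY, MODULO THE IN-FLIGHT ROWS.**  For a Cartan system `Car` of `G_v = U(Φ₃)(L⁺_v)` (`v` non-split) with the ★ CARTAN-ALL letters `hZ` (`T = Z(γ_T)`, `γ_T`
regular), `hcpt` (every `T ≠ M` compact), `hcov`, `hirr` (weylShape), and GIVEN the four in-flight rows — [H-A] CARD A's type-(2) member package with the finer-count rows
(K2E3-p12 (g11) `exists_typeTwo_memberPackage_finer`, head of 02:26:57Z ∕ S4-R41 (1)), [H-A2] its closure «a regular `t ∈ Z(γ₀)` has a block frame in the same `P, e`»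
(`exists_blockFrame_of_mem_centralizer_of_isRegularElt`), [H-C] CARD C's ε-Weyl index `2` of a block-frame element (R90-C131-p05 (g3) `index_centralizer_subgroupOf_epsNormalizer_eq_two_of_typeTwo`),
[H-F1′]∕[H-F2] CARD F's cubic field bridge (K2E3-p27 (g3)) — there is a class count `n : G_v → ℕ` with BOTH ★ `IsStableTransportDict L v Car n` AND ★ `IsTwistedWeylCountT L v Car n`:
one call of ★ p864386 `isStableTransportDict_and_isTwistedWeylCountT_of_forall_member` on the member packages chosen by the priority chain type (1) ▸ type (2) ▸ cheap (module docstring),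
with `μ = 4 ∕ 2 ∕ 1`, `wF = 6 ∕ 2 ∕ [N(T):T]`, `N i k′ = #{j : τ_i j = k′}`, `n t = μ_{T(t)}` on regular `t` (`T(t)` = the unique member containing `t`), ★ `IsFinerCount` from the rows
X1 (reachability), X2 (count), X3 (type transport), (F5) = ★ `index_centralizer_subgroupOf_normalizer_ne_zero`, and (W̃ε-VAL) = ★ p864420 (type (1), at an arbitrary regular `tk` via ★
F3a) ∕ [H-A2]+[H-C] (type (2)) ∕ ★ p864427 (cheap). [cite: Rogawski1990, §3.6 pp. 28–31; §12.5 pp. 182, 186] [cite: HarishChandra1970, Lemma 42] -/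
theorem stableTransportDictCountT_of_rows (hv : ∀ w : PlacesOver L v, IsCMField.complexConj L • w.1 = w.1) {Car : Finset (Subgroup (Gqs L v))}
    (hZ : ∀ T ∈ Car, ∃ γ : Gqs L v, IsRegularElt (γ.val : GL (Fin 3) (LocalRing L v)) ∧ T = Subgroup.centralizer ({γ} : Set (Gqs L v)))
    (hcpt : ∀ T ∈ Car, T ≠ (cmBorelTriple L 3 v).M → IsCompact (T : Set (Gqs L v)))
    (hcov : ∀ γ : Gqs L v, IsRegularElt (γ.val : GL (Fin 3) (LocalRing L v)) →
      ∃ T ∈ Car, ∃ x : Gqs L v, ∀ g : Gqs L v, g ∈ Subgroup.centralizer ({γ} : Set (Gqs L v)) ↔ x⁻¹ * g * x ∈ T)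
    (hirr : ∀ T ∈ Car, ∀ T' ∈ Car, T ≠ T' → ∀ y : Gqs L v, ¬ ∀ h : Gqs L v, h ∈ T' ↔ y⁻¹ * h * y ∈ T)
    -- [H-A] CARD A (K2E3-p12 (g11)): the type-(2) member package with the finer-count rows, head of record (02:26:57Z; S4-R41 (1))
    (HA : ∀ (i : ↥Car) (γ₀ : Gqs L v) (P : GL (Fin 3) (LocalRing L v)) (e : Fin 2 ⊕ Fin 1 ≃ Fin 3) (A : Matrix (Fin 2) (Fin 2) (LocalRing L v)) (u : LocalRing L v),
      γ₀.val.val * P.val = P.val * Matrix.reindex e e (Matrix.fromBlocks A 0 0 !![u]) → Irreducible A.charpoly →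
      (i : Subgroup (Gqs L v)) = Subgroup.centralizer ({γ₀} : Set (Gqs L v)) →
      ∃ (τ : Fin 2 → ↥Car) (e' : ∀ j : Fin 2, ↥(i : Subgroup (Gqs L v)) ≃ₜ* ↥((τ j : ↥Car) : Subgroup (Gqs L v))),
        (∀ (j : Fin 2) (t : ↥(i : Subgroup (Gqs L v))),
            IsStablyConjGAt L (R90.S4.splitFormGL L) v (t : Gqs L v) ((e' j t : ↥((τ j : ↥Car) : Subgroup (Gqs L v))) : Gqs L v)) ∧
        (∀ (j : Fin 2) (t : ↥(i : Subgroup (Gqs L v))), IsRegularElt (((t : Gqs L v)).val : GL (Fin 3) (LocalRing L v)) →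
            cartanWeight L v ((τ j : ↥Car) : Subgroup (Gqs L v)) (e' j t) = cartanWeight L v (i : Subgroup (Gqs L v)) t) ∧
        (∀ t : ↥(i : Subgroup (Gqs L v)), IsRegularElt (((t : Gqs L v)).val : GL (Fin 3) (LocalRing L v)) →
            Set.BijOn (fun j : Fin 2 => ConjClasses.mk ((e' j t : ↥((τ j : ↥Car) : Subgroup (Gqs L v))) : Gqs L v)) Set.univ
              {c : ConjClasses (Gqs L v) | IsStablyConjGAt L (R90.S4.splitFormGL L) v (t : Gqs L v) (Quotient.out c)}) ∧
        (∀ k : ↥Car, (∃ j, τ j = k) ↔ ∃ (t : ↥(i : Subgroup (Gqs L v))) (t'' : ↥(k : Subgroup (Gqs L v))),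
            IsRegularElt (((t : Gqs L v)).val : GL (Fin 3) (LocalRing L v)) ∧ IsStablyConjGAt L (R90.S4.splitFormGL L) v (t : Gqs L v) (t'' : Gqs L v)) ∧
        (∀ k : ↥Car, (∃ j, τ j = k) →
            Nat.card {j : Fin 2 // τ j = k} * (((k : Subgroup (Gqs L v)).subgroupOf (Subgroup.normalizer ((k : Subgroup (Gqs L v)) : Set (Gqs L v)))).index) = 2) ∧
        (∀ k : ↥Car, (∃ j, τ j = k) → ∃ (γ' : Gqs L v) (P' : GL (Fin 3) (LocalRing L v)) (e'' : Fin 2 ⊕ Fin 1 ≃ Fin 3)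
            (A' : Matrix (Fin 2) (Fin 2) (LocalRing L v)) (u' : LocalRing L v),
            γ'.val.val * P'.val = P'.val * Matrix.reindex e'' e'' (Matrix.fromBlocks A' 0 0 !![u']) ∧ Irreducible A'.charpoly ∧
              (k : Subgroup (Gqs L v)) = Subgroup.centralizer ({γ'} : Set (Gqs L v))))
    -- [H-A2] CARD A closure (S4-R41 (1)): a regular `t ∈ Z(γ₀)` has a block frame in the same `P, e`
    (HA2 : ∀ (γ₀ : Gqs L v) (P : GL (Fin 3) (LocalRing L v)) (e : Fin 2 ⊕ Fin 1 ≃ Fin 3) (A : Matrix (Fin 2) (Fin 2) (LocalRing L v)) (u : LocalRing L v),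
      γ₀.val.val * P.val = P.val * Matrix.reindex e e (Matrix.fromBlocks A 0 0 !![u]) → Irreducible A.charpoly →
      ∀ t : Gqs L v, t ∈ Subgroup.centralizer ({γ₀} : Set (Gqs L v)) → IsRegularElt (t.val : GL (Fin 3) (LocalRing L v)) →
        ∃ (B : Matrix (Fin 2) (Fin 2) (LocalRing L v)) (c : LocalRing L v),
          t.val.val * P.val = P.val * Matrix.reindex e e (Matrix.fromBlocks B 0 0 !![c]) ∧ Irreducible B.charpoly)
    -- [H-C] CARD C (R90-C131-p05 (g3)): the ε-Weyl index of a block-frame element is `2`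
    (HC : ∀ (γ₀ : Gqs L v) (P : GL (Fin 3) (LocalRing L v)) (e : Fin 2 ⊕ Fin 1 ≃ Fin 3) (A : Matrix (Fin 2) (Fin 2) (LocalRing L v)) (u : LocalRing L v),
      γ₀.val.val * P.val = P.val * Matrix.reindex e e (Matrix.fromBlocks A 0 0 !![u]) → Irreducible A.charpoly →
      ∀ N' : Subgroup (GtLoc L v),
        (∀ m : GtLoc L v, m ∈ N' ↔
          m ∈ Subgroup.normalizer ((Subgroup.centralizer ({(γ₀.val : GtLoc L v)} : Set (GtLoc L v)) : Subgroup (GtLoc L v)) : Set (GtLoc L v)) ∧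
            m * (epsLoc L (R90.S4.splitFormGL L) v m)⁻¹ ∈ Subgroup.centralizer ({(γ₀.val : GtLoc L v)} : Set (GtLoc L v))) →
        ((Subgroup.centralizer ({(γ₀.val : GtLoc L v)} : Set (GtLoc L v))).subgroupOf N').index = 2)
    -- [H-F1′] CARD F §1′ (K2E3-p27 (g3)): an irreducible characteristic polynomial makes the Cartan algebra a field
    (HF1 : ∀ γ : Gqs L v, Irreducible (γ.val.val : Matrix (Fin 3) (Fin 3) (LocalRing L v)).charpoly →
      IsField ↥(cartanAlgebra (γ.val.val : Matrix (Fin 3) (Fin 3) (LocalRing L v))))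
    -- [H-F2] CARD F §2 corollary (K2E3-p27 (g3)): the field property passes to every regular element of the centraliser
    (HF2 : ∀ γ t : Gqs L v, IsRegularElt (γ.val : GL (Fin 3) (LocalRing L v)) →
      IsField ↥(cartanAlgebra (γ.val.val : Matrix (Fin 3) (Fin 3) (LocalRing L v))) → t ∈ Subgroup.centralizer ({γ} : Set (Gqs L v)) →
      IsRegularElt (t.val : GL (Fin 3) (LocalRing L v)) → IsField ↥(cartanAlgebra (t.val.val : Matrix (Fin 3) (Fin 3) (LocalRing L v)))) :
    ∃ n : Gqs L v → ℕ, IsStableTransportDict L v Car n ∧ IsTwistedWeylCountT L v Car n := by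
  classical
  have hcov' := cartanCover_map_of_weylShape hcov
  have hirr' := cartanIrr_map_of_weylShape hirr
  -- the two intrinsic type letters, and the counts by the priority chain type (1) ▸ type (2) ▸ cheap
  obtain ⟨P1, hP1⟩ : ∃ P1 : ↥Car → Prop, ∀ i, P1 i ↔ ∃ (γ : Gqs L v) (u : Fin 3 → LocalRing L v), Function.Injective u ∧
      (∀ k, conjLocal L (IsCMField.complexConj L) v (u k) * u k = 1) ∧ γ.val.val.charpoly = ∏ k, (Polynomial.X - Polynomial.C (u k)) ∧
      (i : Subgroup (Gqs L v)) = Subgroup.centralizer ({γ} : Set (Gqs L v)) := ⟨_, fun _ => Iff.rfl⟩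
  obtain ⟨P2, hP2⟩ : ∃ P2 : ↥Car → Prop, ∀ i, P2 i ↔ ∃ (γ : Gqs L v) (P : GL (Fin 3) (LocalRing L v)) (e : Fin 2 ⊕ Fin 1 ≃ Fin 3)
      (A : Matrix (Fin 2) (Fin 2) (LocalRing L v)) (u : LocalRing L v),
      γ.val.val * P.val = P.val * Matrix.reindex e e (Matrix.fromBlocks A 0 0 !![u]) ∧ Irreducible A.charpoly ∧
        (i : Subgroup (Gqs L v)) = Subgroup.centralizer ({γ} : Set (Gqs L v)) := ⟨_, fun _ => Iff.rfl⟩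
  obtain ⟨μ, hμ⟩ : ∃ μ : ↥Car → ℕ, ∀ i, μ i = if P1 i then 4 else if P2 i then 2 else 1 := ⟨_, fun _ => rfl⟩
  obtain ⟨wF, hwF⟩ : ∃ wF : ↥Car → ℕ, ∀ i, wF i = if P1 i then 6 else if P2 i then 2 else
      ((i : Subgroup (Gqs L v)).subgroupOf (Subgroup.normalizer ((i : Subgroup (Gqs L v)) : Set (Gqs L v)))).index := ⟨_, fun _ => rfl⟩
  -- the cheap branch: stable class = class
  have hcheap : ∀ i : ↥Car, ¬ P1 i → ¬ P2 i → ∀ t : ↥(i : Subgroup (Gqs L v)), IsRegularElt (((t : Gqs L v)).val : GL (Fin 3) (LocalRing L v)) →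
      ∀ γ' : Gqs L v, IsStablyConjGAt L (R90.S4.splitFormGL L) v (t : Gqs L v) γ' → IsConj (t : Gqs L v) γ' :=
    fun i h1 h2 => stable_eq_class_of_not_typeOne_of_not_typeTwo hv hZ hcpt HF1 HF2 i (fun h => h1 ((hP1 i).2 h)) (fun h => h2 ((hP2 i).2 h))
  -- THE MEMBER PACKAGES, one uniform shape: (S)(W)(B) + X1 reachability + X2 count + X3 type transport
  have hpkg : ∀ i : ↥Car, ∃ (k : ℕ) (τ : Fin k → ↥Car) (e : ∀ j : Fin k, ↥(i : Subgroup (Gqs L v)) ≃ₜ* ↥((τ j : ↥Car) : Subgroup (Gqs L v))),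
      k = μ i ∧
      (∀ (j : Fin k) (t : ↥(i : Subgroup (Gqs L v))),
          IsStablyConjGAt L (R90.S4.splitFormGL L) v (t : Gqs L v) ((e j t : ↥((τ j : ↥Car) : Subgroup (Gqs L v))) : Gqs L v)) ∧
      (∀ (j : Fin k) (t : ↥(i : Subgroup (Gqs L v))), IsRegularElt (((t : Gqs L v)).val : GL (Fin 3) (LocalRing L v)) →
          cartanWeight L v ((τ j : ↥Car) : Subgroup (Gqs L v)) (e j t) = cartanWeight L v (i : Subgroup (Gqs L v)) t) ∧
      (∀ t : ↥(i : Subgroup (Gqs L v)), IsRegularElt (((t : Gqs L v)).val : GL (Fin 3) (LocalRing L v)) →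
          Set.BijOn (fun j : Fin k => ConjClasses.mk ((e j t : ↥((τ j : ↥Car) : Subgroup (Gqs L v))) : Gqs L v)) Set.univ
            {c : ConjClasses (Gqs L v) | IsStablyConjGAt L (R90.S4.splitFormGL L) v (t : Gqs L v) (Quotient.out c)}) ∧
      (∀ k' : ↥Car, (∃ j, τ j = k') ↔ ∃ (t : ↥(i : Subgroup (Gqs L v))) (t'' : ↥(k' : Subgroup (Gqs L v))),
          IsRegularElt (((t : Gqs L v)).val : GL (Fin 3) (LocalRing L v)) ∧ IsStablyConjGAt L (R90.S4.splitFormGL L) v (t : Gqs L v) (t'' : Gqs L v)) ∧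
      (∀ k' : ↥Car, (∃ j, τ j = k') →
          Nat.card {j : Fin k // τ j = k'} * (((k' : Subgroup (Gqs L v)).subgroupOf (Subgroup.normalizer ((k' : Subgroup (Gqs L v)) : Set (Gqs L v)))).index) = wF i) ∧
      (∀ k' : ↥Car, (∃ j, τ j = k') → μ k' = μ i ∧ wF k' = wF i) := by
    intro i
    by_cases h1 : P1 i
    · -- TYPE (1): ★ F5b
      obtain ⟨γ, u, hu, hu1, hchar, hi⟩ := (hP1 i).1 h1
      obtain ⟨τ, e, hS, hW, hB, hT1, hT2, hT3⟩ := exists_typeOne_memberPackage_finer hv i hu hu1 hchar hi hZ hcov' hirr'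
      refine ⟨4, τ, e, by rw [hμ, if_pos h1], hS, hW, hB, hT1, fun k hk => ?_, fun k hk => ?_⟩
      · rw [hwF, if_pos h1]
        exact hT2 k hk
      · obtain ⟨γ', hchar', hk'⟩ := hT3 k hk
        have hP1k : P1 k := (hP1 k).2 ⟨γ', u, hu, hu1, hchar', hk'⟩
        exact ⟨by rw [hμ, hμ, if_pos hP1k, if_pos h1], by rw [hwF, hwF, if_pos hP1k, if_pos h1]⟩
    · by_cases h2 : P2 i
      · -- TYPE (2): [H-A]
        obtain ⟨γ, P, e₀, A, u, hP, hA, hi⟩ := (hP2 i).1 h2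
        obtain ⟨τ, e, hS, hW, hB, hT1, hT2, hT3⟩ := HA i γ P e₀ A u hP hA hi
        refine ⟨2, τ, e, by rw [hμ, if_neg h1, if_pos h2], hS, hW, hB, hT1, fun k hk => ?_, fun k hk => ?_⟩
        · rw [hwF, if_neg h1, if_pos h2]
          exact hT2 k hk
        · obtain ⟨γ', P', e', A', u', hP', hA', hk'⟩ := hT3 k hk
          have hP2k : P2 k := (hP2 k).2 ⟨γ', P', e', A', u', hP', hA', hk'⟩
          -- a reachable member of type (1) would reach `i` back (★ F5b (T1) is symmetric), making `i` of type (1)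
          have hP1k : ¬ P1 k := by
            intro hP1k
            obtain ⟨γ'', u'', hu'', hu1'', hchar'', hk''⟩ := (hP1 k).1 hP1k
            obtain ⟨τ', e'', -, -, -, hT1', -, hT3'⟩ := exists_typeOne_memberPackage_finer hv k hu'' hu1'' hchar'' hk'' hZ hcov' hirr'
            obtain ⟨t, t'', ht, hst⟩ := (hT1 k).1 hk
            have hki : ∃ j, τ' j = i := (hT1' i).2 ⟨t'', t, isRegularElt_of_isConj hst ht, IsConj.symm hst⟩
            obtain ⟨γ₃, hchar₃, hi₃⟩ := hT3' i hki
            exact h1 ((hP1 i).2 ⟨γ₃, u'', hu'', hu1'', hchar₃, hi₃⟩)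
          exact ⟨by rw [hμ, hμ, if_neg hP1k, if_pos hP2k, if_neg h1, if_pos h2], by rw [hwF, hwF, if_neg hP1k, if_pos hP2k, if_neg h1, if_pos h2]⟩
      · -- CHEAP: `M` or cubic — stable class = class (§4), ★ `exists_memberPackage_of_stable_eq_class`
        have hT := hcheap i h1 h2
        obtain ⟨k, τ, e, hk, hcard, hS, hW, hB⟩ := exists_memberPackage_of_stable_eq_class L v i hT
        subst hk
        have hreach : ∀ k' : ↥Car, (∃ j, τ j = k') ↔ k' = i := by
          intro k'
          constructor
          · rintro ⟨j, rfl⟩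
            by_contra hne
            have h0 : Nat.card {j' : Fin 1 // τ j' = τ j} = 0 := by rw [hcard, if_neg hne]
            exact (natCard_fiber_ne_zero_iff τ (τ j)).2 ⟨j, rfl⟩ h0
          · intro hk'i
            rw [hk'i]
            have hne : Nat.card {j : Fin 1 // τ j = i} ≠ 0 := by rw [hcard, if_pos rfl]; exact one_ne_zero
            exact (natCard_fiber_ne_zero_iff τ i).1 hne
        refine ⟨1, τ, e, by rw [hμ, if_neg h1, if_neg h2], hS, hW, hB, fun k' => ?_, fun k' hk' => ?_, fun k' hk' => ?_⟩
        · rw [hreach]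
          constructor
          · intro hk'i
            rw [hk'i]
            obtain ⟨γ₀, hreg, hi⟩ := hZ (i : Subgroup (Gqs L v)) i.2
            have hγ₀i : γ₀ ∈ (i : Subgroup (Gqs L v)) := by
              rw [hi]
              exact Subgroup.mem_centralizer_singleton_iff.2 rfl
            exact ⟨⟨γ₀, hγ₀i⟩, ⟨γ₀, hγ₀i⟩, hreg, isStablyConjGAt_of_isConj (IsConj.refl _)⟩
          · rintro ⟨t, t'', ht, hst⟩
            exact (Subtype.ext (member_eq_of_isConj hZ hirr' i.2 k'.2 t.2 t''.2 ht (isRegularElt_of_isConj hst ht) (hT t ht _ hst))).symm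
        · have hk'i := (hreach k').1 hk'
          rw [hk'i, hcard, if_pos rfl, one_mul, hwF, if_neg h1, if_neg h2]
        · have hk'i := (hreach k').1 hk'
          rw [hk'i]
          exact ⟨rfl, rfl⟩
  choose kk τ e hk hS hW hB hX1 hX2 hX3 using hpkg
  -- the class-count function on `G_v`: `μ` of the unique member containing the regular `t`
  obtain ⟨n, hn⟩ : ∃ n : Gqs L v → ℕ, ∀ t, n t =
      if h : ∃ i : ↥Car, t ∈ (i : Subgroup (Gqs L v)) ∧ IsRegularElt (t.val : GL (Fin 3) (LocalRing L v)) then μ h.choose else 0 :=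
    ⟨_, fun _ => rfl⟩
  refine ⟨n, isStableTransportDict_and_isTwistedWeylCountT_of_forall_member L v hZ hirr μ (fun i k' => Nat.card {j : Fin (kk i) // τ i j = k'}) wF
    (fun i => ⟨kk i, τ i, e i, hk i, fun _ => rfl, hS i, hW i, hB i⟩) ?_ ?_ ?_⟩
  · -- (N): `n t = μ i` for `t ∈ T_i` regular
    intro i t ht
    have hex : ∃ i' : ↥Car, (t : Gqs L v) ∈ (i' : Subgroup (Gqs L v)) ∧ IsRegularElt (((t : Gqs L v)).val : GL (Fin 3) (LocalRing L v)) := ⟨i, t.2, ht⟩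
    rw [hn, dif_pos hex, member_eq_of_mem_of_isRegularElt hZ hex.choose_spec.1 t.2 ht]
  · -- ★ `IsFinerCount μ N [N(T):T] wF` from X1–X3, (F5) ★, (F6) generic
    refine ⟨fun i k hik => ?_, fun i k hik => ?_, fun i k hik => ?_, fun i => ?_, fun i => ?_, fun i => ?_⟩
    · have hr := (natCard_fiber_ne_zero_iff (τ i) k).1 hik
      show Nat.card {j : Fin (kk i) // τ i j = k} *
          ((k : Subgroup (Gqs L v)).subgroupOf (Subgroup.normalizer ((k : Subgroup (Gqs L v)) : Set (Gqs L v)))).index = wF k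
      rw [(hX3 i k hr).2]
      exact hX2 i k hr
    · have hr := (natCard_fiber_ne_zero_iff (τ i) k).1 hik
      exact ⟨(hX3 i k hr).1.symm, (hX3 i k hr).2.symm⟩
    · have hr := (natCard_fiber_ne_zero_iff (τ i) k).1 hik
      obtain ⟨t, t'', ht, hst⟩ := (hX1 i k).1 hr
      exact (natCard_fiber_ne_zero_iff (τ k) i).2 ((hX1 k i).2 ⟨t'', t, isRegularElt_of_isConj hst ht, IsConj.symm hst⟩)
    · obtain ⟨γ₀, hreg, hi⟩ := hZ (i : Subgroup (Gqs L v)) i.2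
      have hγ₀i : γ₀ ∈ (i : Subgroup (Gqs L v)) := by
        rw [hi]
        exact Subgroup.mem_centralizer_singleton_iff.2 rfl
      exact (natCard_fiber_ne_zero_iff (τ i) i).2 ((hX1 i i).2 ⟨⟨γ₀, hγ₀i⟩, ⟨γ₀, hγ₀i⟩, hreg, isStablyConjGAt_of_isConj (IsConj.refl _)⟩)
    · obtain ⟨γ₀, hreg, hi⟩ := hZ (i : Subgroup (Gqs L v)) i.2
      show 0 < ((i : Subgroup (Gqs L v)).subgroupOf (Subgroup.normalizer ((i : Subgroup (Gqs L v)) : Set (Gqs L v)))).index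
      rw [hi]
      exact Nat.pos_of_ne_zero (F0P3cStCharTSWeylFinite.index_centralizer_subgroupOf_normalizer_ne_zero L v hv γ₀ hreg)
    · rw [← hk i]
      exact sum_natCard_fiber_eq (τ i)
  · -- (W̃ε-VAL): `[Ñ^ε_{T_k} : T̃_k] = wF k` at every regular `tk ∈ T_k`
    intro k tk htk N' hN'
    by_cases h1 : P1 k
    · obtain ⟨γ, u, hu, hu1, hchar, hk'⟩ := (hP1 k).1 h1
      obtain ⟨P, hP⟩ := exists_eigenframe_of_typeOne L (qsForm L) v hv γ u hu hchar
      have htkZ : (tk : Gqs L v) ∈ Subgroup.centralizer ({γ} : Set (Gqs L v)) := hk' ▸ tk.2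
      obtain ⟨ν, hν, hνinj, hν1⟩ := exists_eigenframe_coords_of_mem_centralizer hv hP hu hu1 htkZ htk
      rw [hwF, if_pos h1]
      exact index_centralizer_subgroupOf_epsNormalizer_eq_six_of_typeOne L (R90.S4.splitFormGL L) v hv (tk : Gqs L v) ν hνinj hν1 P hν N' hN'
    · by_cases h2 : P2 k
      · obtain ⟨γ, P, e₀, A, u, hP, hA, hk'⟩ := (hP2 k).1 h2
        have htkZ : (tk : Gqs L v) ∈ Subgroup.centralizer ({γ} : Set (Gqs L v)) := hk' ▸ tk.2
        obtain ⟨B, c, hB', hBirr⟩ := HA2 γ P e₀ A u hP hA (tk : Gqs L v) htkZ htk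
        rw [hwF, if_neg h1, if_pos h2]
        exact HC (tk : Gqs L v) P e₀ B c hB' hBirr N' hN'
      · rw [hwF, if_neg h1, if_neg h2]
        exact index_epsNormalizer_eq_weylIndex_member_of_stable_eq_class hZ k (hcheap k h1 h2) tk htk N' hN'

/-! ## §6 THE SOCKET OF RECORD: `stub_R90_S4_stableTransportDictCountT` of Lines-C ED. 6, paid -/

/-- **(DICT)+(WEYL-COUNT-T) — THE STABLE TRANSPORT DICTIONARY AND THE T-SIDE WEYL COUNT OF A CARTAN SYSTEM OF `U(Φ₃)(L⁺_v)`** (`v` non-split): for a complete irredundant finite set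
`C ∋ M` of Cartan subgroups `T = Z(γ₀)` (`γ₀` regular, every `T ≠ M` compact; letters `hZ hcpt hcov hirr` in weylShape) there is `n : G_v → ℕ` with ★ `IsStableTransportDict L v C n`
(§3.6, §12.5 p. 182) AND ★ `IsTwistedWeylCountT L v C n` (p. 186): §5 with its five rows discharged by ★ CARD A (at §1's map-shape `hcov`∕`hirr`), ★ K2E3-p12's closure, ★ CARD C
(at `Φ := splitFormGL L`), ★ CARD F.  STATEMENT = the ∀-body of `stub_R90_S4_stableTransportDictCountT` (R90-C131-typ1 `ED6_probe.v2.lean` :31–:42) with `GLoc L v` spelled `Gqs L v`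
(reducibly equal); `hM` is not consumed (binder `_hM`; the typist's `exact` is positional). [cite: Rogawski1990, §3.6 pp. 28–31; §12.5 pp. 182, 186] [cite: HarishChandra1970, Lemma 42] -/
theorem stableTransportDictCountT_of_record (hv : ∀ w : PlacesOver L v, IsCMField.complexConj L • w.1 = w.1)
    (C : Finset (Subgroup (Gqs L v))) (_hM : (cmBorelTriple L 3 v).M ∈ C)
    (hZ : ∀ T ∈ C, ∃ γ₀ : Gqs L v, IsRegularElt (γ₀.val : GL (Fin 3) (LocalRing L v)) ∧ T = Subgroup.centralizer ({γ₀} : Set (Gqs L v)))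
    (hcpt : ∀ T ∈ C, T ≠ (cmBorelTriple L 3 v).M → IsCompact (T : Set (Gqs L v)))
    (hcov : ∀ γ : Gqs L v, IsRegularElt (γ.val : GL (Fin 3) (LocalRing L v)) →
      ∃ T ∈ C, ∃ x : Gqs L v, ∀ g : Gqs L v, g ∈ Subgroup.centralizer ({γ} : Set (Gqs L v)) ↔ x⁻¹ * g * x ∈ T)
    (hirr : ∀ T ∈ C, ∀ T' ∈ C, T ≠ T' → ∀ y : Gqs L v, ¬ ∀ h : Gqs L v, h ∈ T' ↔ y⁻¹ * h * y ∈ T) :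
    ∃ n : Gqs L v → ℕ, IsStableTransportDict L v C n ∧ IsTwistedWeylCountT L v C n :=
  stableTransportDictCountT_of_rows hv hZ hcpt hcov hirr
    (fun i _ P e A u hP hA hi =>
      exists_typeTwo_memberPackage_finer hv i P e A u hP hA hi hZ (cartanCover_map_of_weylShape hcov) (cartanIrr_map_of_weylShape hirr))
    (fun _ P e A u hP hA _ ht hreg => exists_blockFrame_of_mem_centralizer_of_isRegularElt hv P e A u hP hA ht hreg)
    (fun γ₀ P e A u hP hA N' hN' =>
      index_centralizer_subgroupOf_epsNormalizer_eq_two_of_typeTwo L (R90.S4.splitFormGL L) v hv γ₀ P e A u hP hA N' hN')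
    (fun _ hirr' => isField_cartanAlgebra_of_irreducible_charpoly_gqs hv hirr')
    (fun _ _ hγ hfield ht htreg => isField_cartanAlgebra_of_mem_centralizer_of_isRegularElt hγ hfield ht htreg)

end Assembly

end Summit.HodgeConjecture.HodgeConjecture.R90.S4

end
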